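import Summits.Ventures.PercRepro.Night2ExcessCellsA
import Summits.Ventures.PercRepro.Night2ExcessCellsB
import Summits.Ventures.PercRepro.Night2ExcessCellsC
import Summits.Ventures.PercRepro.Night2ExcessCellsD

/-!
# PercRepro — the `(7, 5)` shadow row modulo the SHRUNK fat-hyperplane residues (night-2, gen 20)

`shadowHall_seven_five_of_residues` (gen 19) reduced the `(7, 5)` shadow row to five residues.  The per-basis
excess regime (`Night2ExcessCells*`: the faces of a covering basis cannot all be fat, `Night2FaceSum`) closes
each cell under weaker hypotheses, so **`shadowHall_seven_five_of_residuesB`**: ShadowHall M 7 5 (phiK 7 5) for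
every finite matroid modulo the residues («fat a/m» = a thin member with `|B ∖ K| ≥ a` missing `≤ m` points,
«basis m» = a hyperplane-basis member missing `≤ m`):
* `(2, 0)`: fat 6/3 ∧ (basis 3 ∨ fat 6/2)            [gen 19: fat 0/4 ∧ fat 6/5 ∧ (basis 3 ∨ fat 6/2) ∧ (basis 2 ∨ fat 6/3)];
* `(2, 1)`: fat 5/4 ∧ (basis 3 ∨ fat 5/3)            [gen 19: fat 5/6 ∧ (basis 3 ∨ fat 5/3) ∧ (basis 2 ∨ fat 5/4)];
* `(3, 0)`: `10 ≤ |G| ≤ 13` ∧ fat 6/2 ∧ basis 2      [gen 19: `|G| ≤ 15` ∧ fat 0/3 ∧ fat 6/3 ∧ basis 2];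
* `(3, 1)`: `10 ≤ |G| ≤ 17` ∧ fat 5/2 ∧ basis 4      [gen 19: `|G| ≤ 20` ∧ fat 0/5 ∧ fat 5/3 ∧ basis 4 ∧ (basis 2 ∨ fat 5/2)];
* `(3, 2)`: fat 4/2                                  [gen 19: fat 4/4 ∧ (basis 3 ∨ fat 4/2) ∧ (basis 2 ∨ fat 4/3)].
-/

namespace PercRepro.Shadow

open Finset PerFlat ThmH

section SevenFiveB

variable {α' : Type} [DecidableEq α']

/-- **THE `(7, 5)` SHADOW ROW FOR EVERY FINITE MATROID MODULO THE SHRUNK FAT-HYPERPLANE RESIDUES** (see the module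
docstring for the five residues). -/
theorem shadowHall_seven_five_of_residuesB
    (h20 : ∀ (N : Matroid α') [N.Finite] (G : Finset α'), CellHyp N G →
      (gr N \ G).card = 2 → kColoops N G = 0 → FatMember N G 6 3 →
      (FatBasis N G 6 3 ∨ FatMember N G 6 2) → LocalShadowHall N 5 G)
    (h21 : ∀ (N : Matroid α') [N.Finite] (G : Finset α'), CellHyp N G →
      (gr N \ G).card = 2 → kColoops N G = 1 → FatMember N G 5 4 →
      (FatBasis N G 5 3 ∨ FatMember N G 5 3) → LocalShadowHall N 5 G)
    (h30 : ∀ (N : Matroid α') [N.Finite] (G : Finset α'), CellHyp N G →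
      (gr N \ G).card = 3 → kColoops N G = 0 → 10 ≤ G.card → G.card ≤ 13 → FatMember N G 6 2 →
      FatBasis N G 6 2 → LocalShadowHall N 5 G)
    (h31 : ∀ (N : Matroid α') [N.Finite] (G : Finset α'), CellHyp N G →
      (gr N \ G).card = 3 → kColoops N G = 1 → 10 ≤ G.card → G.card ≤ 17 → FatMember N G 5 2 →
      FatBasis N G 5 4 → LocalShadowHall N 5 G)
    (h32 : ∀ (N : Matroid α') [N.Finite] (G : Finset α'), CellHyp N G →
      (gr N \ G).card = 3 → kColoops N G = 2 → FatMember N G 4 2 → LocalShadowHall N 5 G)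
    (M : Matroid α') [M.Finite] : ShadowHall M 7 5 (phiK 7 5) := by
  apply shadowHall_seven_five_of_local_d_le_three
  intro N _ hs hl hr G hG h2 h3 hk1 hk2
  have hcell : CellHyp N G := ⟨hs, hl, hr, hG⟩
  have hd : (gr N \ G).card = 2 ∨ (gr N \ G).card = 3 := by omega
  rcases hd with hd | hd
  · have hk : kColoops N G = 0 ∨ kColoops N G = 1 := by omega
    rcases hk with hk | hk
    · -- (2, 0)
      by_cases hpa : FatMember N G 6 3
      · by_cases hs2 : FatBasis N G 6 3 ∨ FatMember N G 6 2
        · exact h20 N G hcell hd hk hpa hs2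
        · push Not at hs2
          exact localShadowHall_two_zero_five_of_spread2 hG hd hk hs hl
            (fun B hB h6 => by have := hs2.2 B hB h6; omega)
            (fun B hB h6 => by have := hs2.1 B hB h6; omega)
      · push Not at hpa
        exact localShadowHall_two_zero_five_of_excess hG hd hk hs hl
          (fun B hB h6 => by have := hpa B hB h6; omega)
    · -- (2, 1)
      by_cases hpa : FatMember N G 5 4
      · by_cases hs2 : FatBasis N G 5 3 ∨ FatMember N G 5 3
        · exact h21 N G hcell hd hk hpa hs2
        · push Not at hs2
          exact localShadowHall_two_one_five_of_spread2 hG hd hk hs hl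
            (fun B hB h5 => by have := hs2.2 B hB h5; omega)
            (fun B hB h5 => by have := hs2.1 B hB h5; omega)
      · push Not at hpa
        exact localShadowHall_two_one_five_of_excess hG hd hk hs hl
          (fun B hB h5 => by have := hpa B hB h5; omega)
  · have hk : kColoops N G = 0 ∨ kColoops N G = 1 ∨ kColoops N G = 2 := by omega
    rcases hk with hk | hk | hk
    · -- (3, 0)
      by_cases hcard : 16 ≤ G.card
      · exact localShadowHall_three_zero_five_of_card hG hd hk hs hl hcard
      · by_cases hsmall : G.card ≤ 8
        · exact localShadowHall_of_spread (ρ := 6) (m₀ := 4) hG hd (by norm_num) (by rw [hk])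
            (fun B hB => absurd (thin_card_bound (ρ := 6) hG hd (by norm_num) (by rw [hk]) hB) (by omega))
            (by rw [hk]; unfold phiQ; norm_num)
        · by_cases hpa : FatMember N G 6 2
          · by_cases hs2 : FatBasis N G 6 2
            · by_cases hmid : 10 ≤ G.card ∧ G.card ≤ 13
              · exact h30 N G hcell hd hk hmid.1 hmid.2 hpa hs2
              · exact localShadowHall_three_zero_five_of_excess hG hd hk hs hl (by omega) (by omega)
                  (fun h1 h2 => absurd ⟨h1, h2⟩ hmid)
            · push Not at hs2
              exact localShadowHall_three_zero_five_of_spread2 hG hd hk hs hl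
                (fun B hB _ => two_le_card_sdiff_of_not_lay0 hG (by omega) (mem_thinMembers.1 hB).1
                  (mem_thinMembers.1 hB).2)
                (fun B hB h6 => by have := hs2 B hB h6; omega)
          · push Not at hpa
            exact localShadowHall_three_zero_five_of_excess hG hd hk hs hl (by omega) (by omega)
              (fun _ _ B hB h6 => by have := hpa B hB h6; omega)
    · -- (3, 1)
      by_cases hcard : 21 ≤ G.card
      · exact localShadowHall_three_one_five_of_card hG hd hk hs hl hcard
      · by_cases hsmall : G.card ≤ 8
        · exact localShadowHall_of_spread (ρ := 5) (m₀ := 6) hG hd (by norm_num) (by rw [hk])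
            (fun B hB => absurd (thin_card_bound (ρ := 5) hG hd (by norm_num) (by rw [hk]) hB) (by omega))
            (by rw [hk]; unfold phiQ; norm_num)
        · by_cases hpa : FatMember N G 5 2
          · by_cases hs2 : FatBasis N G 5 4
            · by_cases hmid : 10 ≤ G.card ∧ G.card ≤ 17
              · exact h31 N G hcell hd hk hmid.1 hmid.2 hpa hs2
              · exact localShadowHall_three_one_five_of_excess hG hd hk hs hl (by omega) (by omega)
                  (fun h1 h2 => absurd ⟨h1, h2⟩ hmid)
            · push Not at hs2
              exact localShadowHall_three_one_five_of_spread2 hG hd hk hs hl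
                (fun B hB _ => two_le_card_sdiff_of_not_lay0 hG (by omega) (mem_thinMembers.1 hB).1
                  (mem_thinMembers.1 hB).2)
                (fun B hB h5 => by have := hs2 B hB h5; omega)
          · push Not at hpa
            exact localShadowHall_three_one_five_of_excess hG hd hk hs hl (by omega) (by omega)
              (fun _ _ B hB h5 => by have := hpa B hB h5; omega)
    · -- (3, 2)
      by_cases hpa : FatMember N G 4 2
      · exact h32 N G hcell hd hk hpa
      · push Not at hpa
        exact localShadowHall_three_two_five_of_excess hG hd hk hs hl
          (fun B hB h4 => by have := hpa B hB h4; omega)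

end SevenFiveB

end PercRepro.Shadow
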